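import Literature.NumberTheory.Automorphic.Liu2021.Sec52Defs
import Literature.NumberTheory.Automorphic.Liu2021.AppendixC.SecC4IntegralModelsUniformization
import HarnessLib

/-!
# Liu 2021, §5.2 «Arithmetic invariant functionals» (print pp. 76–80, items 5.12–5.19) — SECTION CARPET
# (statement-exact typing over in-file hypothesis structures; no proof)

[Liu2021] = Yifeng Liu, *Fourier–Jacobi cycles and arithmetic relative trace formula* (with an appendix by Chao Li and Yihang Zhu),
Cambridge J. Math. **9** (2021), no. 1, 1–147 = arXiv:2102.11518.  SOURCE READ: the print text held as
`paper:liu2021-fourier-jacobi-cycles-arithmetic-relative-trace-formula` (page file `pNNNN` = journal page `N`; «p. N Lk» = line `k` of that page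
file).  §5 opens p. 68 L17; §5.1 «A doubling formula for CM data» p. 69; **§5.2 «Arithmetic invariant functionals» p. 76 L15 – p. 80 L99**;
§5.3 p. 80 L100 – p. 90 L13 (companion file `Sec53OrbitalDecomposition`).  Standing sentences (p. 68 L26–33): «We keep the notation from
Section 4. We fix a conjugate symplectic automorphic character `μ` … of weight one, and a `μ`-admissible collection `ε` (Definition 4.12). From
now on, we will restrict ourselves to the Compact Case. We will identify `E` as a subfield of `ℂ` via a fixed complex embedding `τ' ∈ Φ_μ`. Put
`τ := τ'|_F`, and fix a hermitian space `V` that is `τ`-nearby to `𝕍` (Definition C.4). In particular, `V` is anisotropic. Put `G := Res_{F/ℚ} U(V)`,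
and identify `X_K` with the (proper) Shimura variety `Sh(G, h_{V,τ'})_K` under the notation in Remark C.2.»  Dedup (2026-09-02): no tree
declaration cites any item 5.12–5.29 of [Liu2021] (green field; `rg 'cite: Liu2021, … 5.1x/5.2x' lean/Literature` = ∅); squad TL «GO 500»,
deal of TL-plan 02:11:43Z to TL-t13 («§5.2–5.3 → Sec52Sec53ArithmeticInvariantFunctionals.lean, split into two files only if > 60 decls» —
75 declarations, hence split into `Sec52Defs` (Def. 5.14 and the test-function vocabulary, imported here), this file and
`Sec53OrbitalDecomposition`).

## Discipline (as in `Thm418AsPrinted`, `Sec3CyclesHeightPairings` and the squad ruling «in-file hypothesis structures», TL-plan 01:59:30Z)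

Algebraic cycles, Chow groups, Hecke correspondences, the Beilinson–Bloch height pairing, Kudla's generating series, doubling divisors,
integral models and derived tensor products of structure sheaves are not constructed over a general scheme in Mathlib or the tree.  So §5.2
gets ONE hypothesis structure `Sec52Data` (extended to `Sec52IntData` at a good inert prime), PARAMETRISED by the REAL hermitian space `V`
(tree `AppendixC.HermSpace`), the embedding `τ'`, the Shimura system of Remark C.2 (tree `HermSpace.ShimuraSystem`, so `X_K = S.Sh K`) and, for
`Sec52IntData`, the prime `𝔭` — so that the §5.3 companion can instantiate them at the data of the tree's App. C §C.4 carpet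
(`SecC4IntegralModelsUniformization.UniformizationData`: `U.V`, `U.τ'`, `U.S`, `U.𝔭`) — whose REAL fields are the level subgroup
`K ≤ G(𝔸^∞) = V.Gfin` with its printed attributes and the test functions `f ∈ H_{K,ℂ}`, `φ ∈ 𝒮(V(𝔸_E^∞))^K` (REAL function spaces
`heckeAlgebra`, `schwartzInv` on the tree's adelic group and on `V(𝔸_E^∞) = (𝔸_E^∞)^{⊕n}`); the prime-theoretic vocabulary of Def. 5.16 is the
tree's (`SecC4IntegralModelsUniformization.IsInert`, `residueChar`, `IsUnramifiedRatPrime`, `inertSet` = `𝔭̲`, `IsSelfDualFrame`,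
`latticeStabilizer`, READING U3 there: a lattice `Λ_𝔮 ⊆ V(F_𝔮)` is given by a frame `g ∈ ∏_{w∣𝔮} GL_n(E_w)`, `Λ = g · ∏_w 𝒪_w^n`); every other object the text NAMES is a
⟨CARRIER⟩ field with its printed meaning quoted once (⟨CARRIER LAW⟩ = a printed property of a carrier used by a typed sentence); notions
typed by sibling squad files (§3, §4.3, §5.1, App. C) are carried, not restated, with the sibling file named.  Everything the text DEFINES
from those objects is a REAL `def` (Def. 5.12 `IzK`, Def. 5.13 `Zheart`, Def. 5.14, Def. 5.16, (5.9) `ZheartI`, Def. 5.17 `IKp`); every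
CLAIM is a predicate `def … : Prop` on the datum.  NOTHING IS ASSERTED; a consumer takes `(h : Prop519 D)` for ITS OWN datum.
READING L (local model): `E' = E ⊗_F F_v` of Def. 5.14 at a place `v` is the tree's `UnitaryGroup.LocalRing E v = ∏_{w ∣ v} E_w`, and
`U(V)(F_v)` the tree's `UnitaryGroup.«local»` / `localPi` (factor of `U(V)(𝔸_F^∞) = ∏'_v U(V)(F_v)`, `UnitaryGroup.evalPlace`).
READING FS (formal series): a «formal series» of §5 (Def. 3.3; p. 72 `Z(φ)_K := −φ(0) D_K + ∑_{x ∈ U(V)(F)\V(E)^+} ∑_g e^{−2π·Tr_{F/ℚ}(x,x)_V}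
φ(g^{−1}x) Z(x, g)_K`; p. 79 «formal series of divisors», Rem. 5.18 «formal series in `ℂ`») is typed as the family, indexed by `T ∈ E`
(`T = (x, x)_V ∈ F`), of its part of index `T` without the weight `e^{−2π·Tr_{F/ℚ} T}` — by Witt's theorem `U(V)(F)` is transitive on the vectors
of a given length `T ≠ 0`, so the index `T` IS the printed index `x ∈ U(V)(F)\V(E)^+` (and `−φ(0) D_K` sits at `T = 0`); the inner sums over `g`
are finite; every printed operation on formal series is termwise and every printed equality «as formal series» is typed as equality of these
families (equivalent to the printed one, the weights being common nonzero scalars); the passage to an honest Chow class (Def. 3.3) is the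
carrier `czSum`, where the weights re-enter.

## INDEX (item ↦ declaration; namespace `Literature.NumberTheory.Automorphic.Liu2021.Sec52ArithmeticInvariantFunctionals`)

**Def. 5.14** (p. 77) and the test-function spaces of Def. 5.12 ↦ the imported `Sec52Defs` (`IsRelRegularSemisimple`, `relOrbitsRS`,
`IsRegularlySupported`, `IsRegularlySupportedAt`, `heckeAlgebra`, `schwartzInv`, `tensorFn`, `IsDecomposable`, …); over `Sec52Data`: **Def. 5.12** ↦ `Sec52Data.IzK` (`Δ³_z X_K` pinned to `pr^{[3]}_{z_K} Δ³ X_K` by the ⟨CARRIER LAW⟩ `delta3z_spec`, ED.2); conventions (1)(2) p. 76 ↦ the carriers `heckeCorr` (cycle-valued), `inter6`; **Def. 5.13** ↦ `Zheart`;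
p. 77 L5–11 «it is clear …» ↦ `ZheartClear`; **(5.8)** ↦ `Eq58`; **Prop. 5.15** ↦ `Prop515_1`, `Prop515_2`; **Def. 5.16** ↦ `IsGoodInertPrimeWith`
(with witnesses: self-dual frames `Λ_𝔮`, `f^p`, `φ^p`), `IsGoodInertPrime` (+ `latticeOfFrame` = `Λ = g · ∏_w 𝒪_w^n`, `awayG`, `awayV`, `locV`); over `Sec52IntData` (a good inert
prime fixed, p. 79): **(5.9)** ↦ `ZheartI`; **Def. 5.17** ↦ `IKp` (`twoLogNorm 𝔭` = `2 log |𝒪_F/𝔭|`); **Rem. 5.18** ↦ `Rem518`; **Prop. 5.19** ↦ `Prop519`.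
NOT typed: the third clause of p. 77 L5–11 (`cl_B(Z^♥_K) = cl_B(Z_K)`, Lemma 5.6 (2) of §5.1), the discussion p. 78 L34–41, footnotes 11–12
(quoted), proofs.

## References
* [Liu2021] §5.2, pp. 76–80 (Def. 5.12, Def. 5.13 p. 76; (5.8), Def. 5.14, Prop. 5.15 p. 77; Def. 5.16 p. 78; (5.9), Def. 5.17, Rem. 5.18
  p. 79; Prop. 5.19 p. 80); §4.3 p. 57 (level subgroups, `H_{K,R}`, `T_K`); §5.1 pp. 71–74 (Def. 5.3, `Z(φ)_K`, Def. 5.8); §3 (Def. 3.3, (3.1));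
  p. 67 (`Δ³_z X_K`); App. C (Rem. C.2, Def. C.21).
-/

noncomputable section

open CategoryTheory
open scoped TensorProduct Matrix
open NumberField IsDedekindDomain
open Literature.NumberTheory.Automorphic.Liu2021.AppendixC (conj HermSpace)
open Literature.NumberTheory.Automorphic.Liu2021.AppendixC.SecC4IntegralModelsUniformization
  (IsInert residueChar IsUnramifiedRatPrime inertSet localGroup IsSelfDualFrame latticeStabilizer)
open Literature.NumberTheory.Automorphic.Liu2021.Sec52Defs

namespace Literature.NumberTheory.Automorphic.Liu2021.Sec52ArithmeticInvariantFunctionals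

section Sec52

variable {F E : Type} [Field F] [NumberField F] [IsTotallyReal F] [Field E] [NumberField E] [Algebra F E]
  [IsTotallyComplex E] [Algebra.IsQuadraticExtension F E]

/-! ## Auxiliary REAL vocabulary for Definition 5.16 (lattices from frames; components away from a set of places) -/

section Aux

variable (V : HermSpace F E)

/-- The lattice «`Λ_𝔮 ⊆ V(F_𝔮)`» spanned by a frame `g = (g_w)_{w ∣ 𝔮} ∈ ∏_{w∣𝔮} GL_n(E_w)`: `Λ = g · ∏_{w∣𝔮} 𝒪_w^n ⊆ V(F_𝔮) = ∏_{w∣𝔮} E_w^n`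
(READING U3 of the tree's `SecC4IntegralModelsUniformization`: `IsSelfDualFrame`, `latticeStabilizer` are stated on frames), as a subset of
`V(E_𝔮) = E_𝔮^{⊕n}` — for «`φ_𝔮 = 𝟙_{Λ_𝔮}`» (Def. 5.16, p. 79 L2–8). REAL. [cite: Liu2021, Def. 5.16 (pp. 78–79)] -/
def latticeOfFrame (𝔮 : HeightOneSpectrum (𝓞 F)) (g : UnitaryGroup.LocalGLPi E V.n 𝔮) :
    Set (Fin V.n → UnitaryGroup.LocalRing E 𝔮) :=
  {x | ∃ y : Fin V.n → UnitaryGroup.LocalRing E 𝔮, (∀ i w, y i w ∈ w.1.adicCompletionIntegers E) ∧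
    x = fun i w => (((g w : GL (Fin V.n) (w.1.adicCompletion E)) : Matrix (Fin V.n) (Fin V.n) (w.1.adicCompletion E)) *ᵥ
      fun j => y j w) i}

/-- The away-from-`S` component `(g_u)_{u ∉ S}` of `g ∈ U(V)(𝔸_F^∞)` for a set `S` of places («`K = K^p × ∏_{𝔮 ∈ 𝔭̲} K_𝔮`», «`f = f^p ⊗ …`»,
p. 78 L50–53: the factor away from `𝔭̲`; equivalently an element of the tree's `awayFrom V S`, READING U4 there). REAL.
[cite: Liu2021, Def. 5.16 (p. 78)] -/
def awayG (S : Set (HeightOneSpectrum (𝓞 F))) (g : V.Gfin) :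
    (u : {u : HeightOneSpectrum (𝓞 F) // u ∉ S}) → UnitaryGroup.localPi E (conj F E) V.n V.gram u.1 :=
  fun u => UnitaryGroup.evalPlace F E (conj F E) V.n V.gram u.1 g

/-- The away-from-`S` component `(x_w)_{w ∤ S}` of `x ∈ V(𝔸_E^∞)` («`φ = φ^p ⊗ …`», p. 79 L2–8). REAL. [cite: Liu2021, Def. 5.16 (p. 79)] -/
def awayV (S : Set (HeightOneSpectrum (𝓞 F))) (x : Sec52Defs.VAd V) :
    (w : {w : HeightOneSpectrum (𝓞 E) // w.under (𝓞 F) ∉ S}) → Fin V.n → w.1.adicCompletion E :=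
  fun w i => (x i) w.1

/-- The `𝔮`-component `x_𝔮 ∈ V(E_𝔮)` of `x ∈ V(𝔸_E^∞)`. REAL. [cite: Liu2021, Def. 5.16 (p. 79)] -/
def locV (𝔮 : HeightOneSpectrum (𝓞 F)) (x : Sec52Defs.VAd V) : Fin V.n → UnitaryGroup.LocalRing E 𝔮 := fun i w => (x i) w.1

/-- `2 log |𝒪_F/𝔭|` (Def. 5.17; footnote 12, p. 79 L76–80: «`c(u)` in (3.1) is `log |𝒪_E/𝔭𝒪_E| = 2 log |𝒪_F/𝔭|`»). REAL (`Ideal.absNorm`).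
[cite: Liu2021, Def. 5.17 (p. 79)] -/
def twoLogNorm (𝔭 : HeightOneSpectrum (𝓞 F)) : ℝ := 2 * Real.log (Ideal.absNorm 𝔭.asIdeal)

end Aux

/-! ## §5.2 Arithmetic invariant functionals (pp. 76–80): the datum -/

variable (F E)

/-- **Data of [Liu2021, §5.2]** — the standing data of §5 (p. 68 L26–33: «We keep the notation from Section 4 … we will restrict
ourselves to the Compact Case. We will identify `E` as a subfield of `ℂ` via a fixed complex embedding `τ' ∈ Φ_μ`. Put `τ := τ'|_F`,
and fix a hermitian space `V` that is `τ`-nearby to `𝕍` (Definition C.4). In particular, `V` is anisotropic. Put `G := Res_{F/ℚ} U(V)`,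
and identify `X_K` with the (proper) Shimura variety `Sh(G, h_{V,τ'})_K` under the notation in Remark C.2»; p. 57 L5–12: «`𝕍` … of
rank `n ≥ 2` … we … will only consider sufficiently small open compact subgroups `K ⊆ G(𝔸_F^∞)` that are decomposable … we call such
`K` a level subgroup») together with the test functions of Definition 5.12 (p. 76 L18–21: «Let `K ⊆ G(𝔸^∞)` be a level subgroup. For
test functions `f ∈ H_{K,ℂ}` and `φ ∈ 𝒮(V(𝔸_E^∞))^K`») and the cycle-theoretic objects §5.2 NAMES on the self-products `X_K^m :=
X_K ×_E ⋯ ×_E X_K` (`m = 1, 2, 3, 6`).  REAL: `V` (tree `AppendixC.HermSpace`), `τ'`, the Shimura system `S` of Remark C.2 (tree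
`HermSpace.ShimuraSystem`, so `X_K = S.Sh K`), `K` with its printed attributes, `f`, `φ` (membership in the REAL `heckeAlgebra`,
`schwartzInv`).  ⟨CARRIER⟩ (objects the text names; their constructions — algebraic cycles, Chow groups, Hecke correspondences,
exterior products, pull-backs, intersection products, the Beilinson–Bloch height pairing, Kudla's generating series, doubling
divisors — are not available over a general scheme in Mathlib or the tree; each is a field with its printed meaning quoted once;
⟨CARRIER LAW⟩ = a printed property of a carrier that a typed sentence below uses).  READING FS («formal series», Def. 3.3 / p. 72 /
p. 79 / Rem. 5.18): a formal series `∑_j c_j Z_j` of §5 is a generating series in the weights `e^{−2π·Tr_{F/ℚ} T}`, `T = (x, x)_V`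
(p. 72: `Z(φ)_K := −φ(0) D_K + ∑_x ∑_g e^{−2π·Tr_{F/ℚ}(x,x)_V} φ(g^{−1}x) Z(x, g)_K`); it is typed as the family `E → M` of its parts of
given index `T ∈ F ⊆ E` WITHOUT the weight (the part of index `T` of `Z(φ)_K` is the finite sum `∑_{(x,x)_V = T} ∑_g φ(g^{−1}x) Z(x,g)_K`,
and `−φ(0) D_K` at `T = 0`); every printed operation on formal series is termwise, and a printed equality «as formal series» is typed
as equality of these families; the passage to an honest class (Def. 3.3, Chow convergence) re-inserts the weights `expWeight T`.
Nothing is asserted; a consumer supplies the datum. [cite: Liu2021, §5.2 (pp. 76–80); §4.3 (p. 57); §5 (p. 68)] -/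
structure Sec52Data (V : HermSpace F E) (τ' : E →+* ℂ) (S : V.ShimuraSystem τ') : Type 2 where
  /-- «of rank `n ≥ 2`» (p. 57 L5–6). -/
  two_le_n : 2 ≤ V.n
  /-- «In particular, `V` is anisotropic» (p. 68 L31). REAL. -/
  anisotropic : ∀ x : V.V, V.form x x = 0 → x = 0
  /-- «a level subgroup `K ⊆ G(𝔸_F^∞)`» (p. 76 L18–19; p. 57 L7–12). -/
  K : Subgroup V.Gfin
  /-- «open compact subgroups» (p. 57 L8): open. REAL. -/
  K_open : IsOpen (K : Set V.Gfin)
  /-- «open compact subgroups» (p. 57 L8): compact. REAL. -/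
  K_compact : IsCompact (K : Set V.Gfin)
  /-- «sufficiently small» (p. 57 L8) — the «neat» carrier of the tree's Shimura system. -/
  K_small : S.IsNeat K
  /-- «decomposable, that is, `K` can be written as `∏_v K_v`» (p. 57 L8–10). REAL. -/
  K_decomp : Sec52Defs.IsDecomposable V K
  /-- «`f ∈ H_{K,ℂ}`» (p. 76 L20). -/
  f : V.Gfin → ℂ
  /-- `f ∈ H_{K,ℂ} = C_c^∞(K\G(𝔸_F^∞)/K, ℂ)`. REAL. -/
  f_mem : f ∈ Sec52Defs.heckeAlgebra V K
  /-- «`φ ∈ 𝒮(V(𝔸_E^∞))^K`» (p. 76 L20–21). -/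
  φ : Sec52Defs.VAd V → ℂ
  /-- `φ ∈ 𝒮(V(𝔸_E^∞))^K`. REAL. -/
  φ_mem : φ ∈ Sec52Defs.schwartzInv V K
  /-- ⟨CARRIER⟩ `Z^i(X_K^m)_ℂ`, the algebraic cycles of codimension `i` on `X_K^m` with complex coefficients (§3.1 `Z^i(X)`; p. 76 L29
  «`Z_K ∈ Z¹(X_K × X_K)_ℂ`»; convention (1), p. 76 L33–34: «We will regard `T^f_K` as an algebraic cycle, rather than a Chow cycle, on
  `X_K × X_K`»), indexed by `(m, i)`. -/
  Zc : ℕ → ℕ → ModuleCat.{0} ℂ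
  /-- ⟨CARRIER⟩ `CH^i(X_K^m)_ℂ`, the Chow groups with complex coefficients (§3.1). -/
  CH : ℕ → ℕ → ModuleCat.{0} ℂ
  /-- ⟨CARRIER⟩ the cycle-class map `Z^i(X_K^m)_ℂ → CH^i(X_K^m)_ℂ` (§3.1 «a natural surjective map `Z^i(X) → CH^i(X)`»). -/
  cl : ∀ m i, Zc m i →ₗ[ℂ] CH m i
  /-- ⟨CARRIER⟩ `CH^i(X_K^m)^0_ℂ ⊆ CH^i(X_K^m)_ℂ`, the homologically trivial classes (Def. 3.1 with `R = ℂ`). -/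
  CH0 : ∀ m i, Submodule ℂ (CH m i)
  /-- ⟨CARRIER⟩ the diagonal `Δ X_K ∈ Z^{n−1}(X_K × X_K)` (p. 57 L31–32: «`T^{𝟙_K}_K = vol(K) · Δ X_K ∈ Z^{n−1}(X_K × X_K)_R`»). -/
  diag : Zc 2 (V.n - 1)
  /-- ⟨CARRIER⟩ «`T_K : H_{K,R} → Z^{n−1}(X_K × X_K)_R` sending `f` to the Hecke correspondence `T^f_K`, normalized by `vol(K)`» (p. 57 L29–31),
  `R = ℂ`, as a function on all `f : G(𝔸^∞) → ℂ` (meaningful on `heckeAlgebra V K`; its construction is §4.3, squad file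
  `Sec43Sec44FourierJacobiCycles` (TL-t01)). -/
  heckeCorr : (V.Gfin → ℂ) → Zc 2 (V.n - 1)
  /-- ⟨CARRIER⟩ «`Δ³_z X_K := pr^{[3]}_{z_K} Δ³ X_K ∈ CH^{2(n−1)}(X_K × X_K × X_K)^0_ℚ`» (p. 67 L30–33), for the Hecke system of projectors
  `z = (z_K)_K` fixed in Conjecture 4.37's set-up (Def. 4.35; squad file `Sec43Sec44FourierJacobiCycles` (TL-t01)), read in `CH_ℂ`. -/
  delta3z : CH 3 (2 * (V.n - 1))
  /-- ⟨CARRIER LAW⟩ «`∈ CH^{2(n−1)}(X_K × X_K × X_K)^0`» (p. 67 L32). -/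
  delta3z_mem : delta3z ∈ CH0 3 (2 * (V.n - 1))
  /-- ⟨CARRIER⟩ the small diagonal `Δ³ X_K` of `X_K³` as a cycle (p. 59 Step 1; p. 78 L39 «we will only consider `Δ³ X_K`»). -/
  diag3 : Zc 3 (2 * (V.n - 1))
  /-- ⟨CARRIER⟩ the projector `pr^{[3]}_{z_K}` acting on `CH^j(X_K × X_K × X_K)_ℂ` (Def. 3.13 — squad file `Sec3CyclesHeightPairings` (TL-t02) `pr3`;
  `z = (z_K)_K` «a Hecke system of projectors» of Def. 4.35 — squad file `Sec44ArithmeticGGP` (TL-t02) `IsHeckeSystemOfProjectors` — fixed on p. 67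
  L28: «Now take a Hecke system of projectors `z = (z_K)_K`»), `ℂ`-linearly (ED.2, squad QA-7). -/
  prz3 : ∀ j, CH 3 j →ₗ[ℂ] CH 3 j
  /-- ⟨CARRIER LAW⟩ the printed DEFINITION «`Δ³_z X_K := pr^{[3]}_{z_K} Δ³ X_K`» (p. 67 L30–31): `delta3z` is `pr^{[3]}_{z_K}` of the class of the small
  diagonal `Δ³ X_K` — so `IzK` below is `I^z_K` for THE printed `Δ³_z X_K`, not for an arbitrary homologically trivial class (ED.2, squad QA-7). -/
  delta3z_spec : delta3z = prz3 _ (cl 3 _ diag3)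
  /-- ⟨CARRIER⟩ the exterior product of cycles `(A, B, C) ↦ A × B × C`, `Z^a(X_K²) × Z^b(X_K²) × Z^c(X_K²) → Z^{a+b+c}(X_K⁶)` (p. 76 L24:
  «`Δ X_K × T^f_K × Z_K`»). -/
  ext3 : ∀ a b c, Zc 2 a → Zc 2 b → Zc 2 c → Zc 6 (a + b + c)
  /-- ⟨CARRIER⟩ the same exterior product on Chow groups `CH^a(X_K²)_ℂ × CH^b(X_K²)_ℂ × CH^c(X_K²)_ℂ → CH^{a+b+c}(X_K⁶)_ℂ` (used in (5.8) on the
  class of the Chow convergent series `Z^♥_K`). -/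
  ext3CH : ∀ a b c, CH 2 a →ₗ[ℂ] CH 2 b →ₗ[ℂ] CH 2 c →ₗ[ℂ] CH 6 (a + b + c)
  /-- ⟨CARRIER LAW⟩ exterior product commutes with taking classes. -/
  cl_ext3 : ∀ a b c (A : Zc 2 a) (B : Zc 2 b) (C : Zc 2 c),
    cl 6 (a + b + c) (ext3 a b c A B C) = ext3CH a b c (cl 2 a A) (cl 2 b B) (cl 2 c C)
  /-- ⟨CARRIER⟩ the pull-backs `p^*_{135}, p^*_{246} : CH^j(X_K³)_ℂ → CH^j(X_K⁶)_ℂ` along the projections `p_{135}, p_{246} : X_K⁶ → X_K³`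
  (p. 76 L24). -/
  p135 : ∀ j, CH 3 j →ₗ[ℂ] CH 6 j
  /-- ⟨CARRIER⟩ `p^*_{246}` (p. 76 L24). -/
  p246 : ∀ j, CH 3 j →ₗ[ℂ] CH 6 j
  /-- ⟨CARRIER LAW⟩ pull-backs preserve homologically trivial classes (cycle class maps commute with pull-back). -/
  pull_mem0 : ∀ j (x : CH 3 j), x ∈ CH0 3 j → p135 j x ∈ CH0 6 j ∧ p246 j x ∈ CH0 6 j
  /-- ⟨CARRIER⟩ the cycles `p^*_{135} Δ³ X_K`, `p^*_{246} Δ³ X_K` on `X_K⁶` (p. 77 L46–53: «the cycles … and `p^*_{246} Δ³ X_K` intersect properly in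
  `X_K⁶`»; partial diagonals, regular subschemes — p. 77 L65–66). -/
  pd135 : Zc 6 (2 * (V.n - 1))
  /-- ⟨CARRIER⟩ `p^*_{246} Δ³ X_K` as a cycle on `X_K⁶`. -/
  pd246 : Zc 6 (2 * (V.n - 1))
  /-- ⟨CARRIER LAW⟩ their classes are the pull-backs of the class of `Δ³ X_K`. -/
  cl_pd : cl 6 _ pd135 = p135 _ (cl 3 _ diag3) ∧ cl 6 _ pd246 = p246 _ (cl 3 _ diag3)
  /-- ⟨CARRIER⟩ the intersection product on the Chow ring of the smooth `X_K⁶`, `CH^a_ℂ × CH^b_ℂ → CH^{a+b}_ℂ`, written `A.B` (p. 76 L24). -/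
  interCH : ∀ a b, CH 6 a →ₗ[ℂ] CH 6 b →ₗ[ℂ] CH 6 (a + b)
  /-- ⟨CARRIER LAW⟩ `CH^*(X_K⁶)^0_ℂ` is an ideal for the intersection product (cycle class maps are multiplicative). -/
  inter_mem0 : ∀ a b (x : CH 6 a) (y : CH 6 b), y ∈ CH0 6 b → interCH a b x y ∈ CH0 6 (a + b)
  /-- ⟨CARRIER⟩ «proper intersection» of two cycles on `X_K⁶` (convention (2), p. 76 L35–37; Prop. 5.15 (1)). -/
  ProperInt6 : ∀ a b, Zc 6 a → Zc 6 b → Prop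
  /-- ⟨CARRIER⟩ convention (2) (p. 76 L35–40): «Whenever we have two cycles `A` and `B` in a regular scheme `X` that have proper intersection,
  `A.B` will be regarded as the cycle `∑_C m_C(A, B) · C` (rather than the associated Chow cycle), where the sum is taken over all irreducible
  components `C` in `A ∩ B` with `m_C(A, B)` the intersection multiplicity» — on `X_K⁶` (meaningful under `ProperInt6`). -/
  inter6 : ∀ a b, Zc 6 a → Zc 6 b → Zc 6 (a + b)
  /-- ⟨CARRIER LAW⟩ under proper intersection the cycle `A.B` represents the product of the classes. -/
  cl_inter6 : ∀ a b (A : Zc 6 a) (B : Zc 6 b), ProperInt6 a b A B →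
    cl 6 (a + b) (inter6 a b A B) = interCH a b (cl 6 a A) (cl 6 b B)
  /-- ⟨CARRIER⟩ «have empty intersection on `X_K⁶`» for two cycles (Prop. 5.15 (2), p. 77 L50–53): their supports are disjoint. -/
  EmptyInt6 : ∀ a b, Zc 6 a → Zc 6 b → Prop
  /-- ⟨CARRIER⟩ the Beilinson–Bloch height pairing `⟨ , ⟩^{BB}_{X_K⁶} : CH^i(X_K⁶)^0_ℂ × CH^j(X_K⁶)^0_ℂ → ℂ` in complementary degrees
  `i + j = dim X_K⁶ + 1 = 6(n−1) + 1` ((3.1) with its `ℂ`-bilinear extension, §3.2; squad file `Sec3CyclesHeightPairings` (TL-t02)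
  `BBHeightPairingData.bbR`; p. 65 L21: «We assume that all height pairings are defined»), as a family in all `(i, j)` of which only the
  complementary pairs are meaningful (the only pair used below is `(2(n−1), 4n−3)`, Def. 5.12). -/
  bb6 : ∀ i j, CH0 6 i →ₗ[ℂ] CH0 6 j →ₗ[ℂ] ℂ
  /-- ⟨CARRIER⟩ the pull-back of cycles `p_2^* : Z^j(X_K)_ℂ → Z^j(X_K × X_K)_ℂ` along «`p_2 : X_K × X_K → X_K` … the projection to the second
  factor» (p. 76 L46–50). -/
  p2pull : ∀ j, Zc 1 j →ₗ[ℂ] Zc 2 j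
  /-- ⟨CARRIER⟩ «has proper intersection with `Δ X_K`» for `Z ∈ Z¹(X_K × X_K)_ℂ` (Def. 5.8, p. 74 L7–8). -/
  ProperIntDiag : Zc 2 1 → Prop
  /-- ⟨CARRIER⟩ `Z ↦ Δ X_K . Z` «where we regard `Δ X_K . Z_K` as in `Z¹(X_K)_ℂ`» (p. 76 L46–49; convention (2)), for `Z` meeting `Δ X_K`
  properly. -/
  interDiag : Zc 2 1 → Zc 1 1
  /-- ⟨CARRIER⟩ «`Z_K ∈ Z¹(X_K × X_K)_ℂ` is … a doubling divisor for `φ` (Definition 5.8, linearly extended to coefficients in `ℂ`)» (p. 76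
  L29–30; Def. 5.8, p. 74 L5–8: «`cl_B(Z_K) = cQ^φ_{μ,K}` and `Z_K` has proper intersection with `Δ X_K`»; squad file
  `Sec51DoublingFormulaCMData` (TL-t12)), as a predicate in `(φ, Z)`. -/
  IsDoublingDivisor : (Sec52Defs.VAd V → ℂ) → Zc 2 1 → Prop
  /-- ⟨CARRIER LAW⟩ a doubling divisor «has proper intersection with `Δ X_K`» (Def. 5.8). -/
  isDoublingDivisor_proper : ∀ ψ Z, IsDoublingDivisor ψ Z → ProperIntDiag Z
  /-- ⟨CARRIER⟩ Kudla's generating series `Z(φ)_K` of special divisors (p. 72 L7–13), «a formal series in `Z¹(X_K)_ℂ`», Chow convergent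
  (Lem. 5.4): under READING FS the family `T ↦` (its part of index `T`), for every `φ ∈ 𝒮(V(𝔸_E^∞))` (squad file
  `Sec51DoublingFormulaCMData` (TL-t12)). -/
  Zphi : (Sec52Defs.VAd V → ℂ) → E → Zc 1 1
  /-- ⟨CARRIER⟩ «Chow convergent» (Def. 3.3; squad file `Sec3CyclesHeightPairings` (TL-t02) `IsChowConvergent`) for a formal series in
  `Z^i(X_K^m)_ℂ` under READING FS (the series `∑_T e^{−2π·Tr_{F/ℚ}T} · s(T)`). -/
  IsChowConvergent : ∀ m i, (E → Zc m i) → Prop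
  /-- ⟨CARRIER⟩ the «natural complex linear map `CZ^i(X) → CH^i(X)_ℂ`» (Def. 3.3, p. 35) on Chow convergent series of `X = X_K^m` under
  READING FS: `s ↦` the sum of `∑_T e^{−2π·Tr_{F/ℚ}T} · [s(T)]` in `CH^i(X_K^m)_ℂ` (meaningful under `IsChowConvergent`). -/
  czSum : ∀ m i, (E → Zc m i) → CH m i

namespace Sec52Data

variable {F E}
variable {V : HermSpace F E} {τ' : E →+* ℂ} {S : V.ShimuraSystem τ'} (D : Sec52Data F E V τ' S)

/-- `X_K = Sh(G, h_{V,τ'})_K`, a scheme over `E` (p. 68 L32–33, Remark C.2) — REAL-valued field of the tree's Shimura system.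
[cite: Liu2021, §5 (p. 68)] -/
abbrev X : Literature.AlgebraicGeometry.Motives.SchemeOver E := S.Sh D.K

/-- `T^f_K ∈ Z^{n−1}(X_K × X_K)_ℂ`, the Hecke correspondence of the datum's `f` (convention (1), p. 76 L33–34). [cite: Liu2021, Def. 5.12 (p. 76)] -/
abbrev Tf : D.Zc 2 (V.n - 1) := D.heckeCorr D.f

/-- **[Liu2021, Definition 5.12] (Global arithmetic invariant functional)** (p. 76 L18–30): «Let `K ⊆ G(𝔸^∞)` be a level subgroup. For
test functions `f ∈ H_{K,ℂ}` and `φ ∈ 𝒮(V(𝔸_E^∞))^K`, we define the global arithmetic invariant functional to be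
`I^z_K(f, φ) := ⟨p^*_{135} Δ³_z X_K, (Δ X_K × T^f_K × Z_K).p^*_{246} Δ³_z X_K⟩^{BB}_{X_K⁶}`, where `Z_K ∈ Z¹(X_K × X_K)_ℂ` is an arbitrary
doubling divisor for `φ`.»  Typed as a function of the chosen doubling divisor `Z` (hypothesis `hZ`, unused in the value): degrees
`(n−1) + (n−1) + 1` for `Δ X_K × T^f_K × Z_K`, `2(n−1)` for `p^* Δ³_z X_K`, and `2(n−1) + (2n−1+2(n−1)) = 6(n−1) + 1` is the complementary
pair (`n ≥ 2`).  The memberships in `CH^0` come from the ⟨CARRIER LAW⟩s `delta3z_mem`, `pull_mem0`, `inter_mem0`. REAL over the carriers.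
[cite: Liu2021, Def. 5.12 (p. 76)] -/
def IzK (Z : D.Zc 2 1) (_hZ : D.IsDoublingDivisor D.φ Z) : ℂ :=
  D.bb6 (2 * (V.n - 1)) ((V.n - 1) + (V.n - 1) + 1 + 2 * (V.n - 1))
    ⟨D.p135 _ D.delta3z, (D.pull_mem0 _ _ D.delta3z_mem).1⟩
    ⟨D.interCH _ _ (D.cl 6 _ (D.ext3 _ _ _ D.diag D.Tf Z)) (D.p246 _ D.delta3z),
      D.inter_mem0 _ _ _ _ (D.pull_mem0 _ _ D.delta3z_mem).2⟩


/-- **[Liu2021, Definition 5.13]** (p. 76 L41–50): «Let `K ⊆ G(𝔸^∞)` be a level subgroup. For a doubling divisor `Z_K ∈ Z¹(X_K × X_K)_ℂ` for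
`φ ∈ 𝒮(V(𝔸_E^∞))^K`, we put `Z^♥_K := Z_K − p_2^*(Δ X_K . Z_K − Z(φ)_K)`, where we regard `Δ X_K . Z_K` as in `Z¹(X_K)_ℂ` and recall that
`p_2 : X_K × X_K → X_K` is the projection to the second factor.»  A formal series in `Z¹(X_K × X_K)_ℂ` (READING FS): its part of index `T` is
`p_2^*` of the part of index `T` of `Z(φ)_K`, plus `Z_K − p_2^*(Δ X_K . Z_K)` at `T = 0`. REAL over the carriers.
[cite: Liu2021, Def. 5.13 (p. 76)] -/
def Zheart (Z : D.Zc 2 1) (T : E) : D.Zc 2 1 :=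
  haveI := Classical.decEq E
  (if T = 0 then Z - D.p2pull 1 (D.interDiag Z) else 0) + D.p2pull 1 (D.Zphi D.φ T)

/-- **[Liu2021, p. 77 L5–11] AS PRINTED** (the sentence after Definition 5.13): «It is clear that `Z^♥_K ∈ CZ¹(X_K × X_K)` (Definition 3.3),
`Δ X_K . Z^♥_K = Z(φ)_K`, `cl_B(Z^♥_K) = cl_B(Z_K)` by Lemma 5.6(2)».  Typed: the first two clauses (Chow convergence of `Z^♥_K`; `Δ X_K . –`
termwise), for every doubling divisor `Z_K` for `φ`; the third (Betti classes, Lemma 5.6 (2) of §5.1) is NOT typed here. NO PROOF.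
[cite: Liu2021, §5.2 (p. 77 L5–11)] -/
def ZheartClear : Prop :=
  ∀ Z, D.IsDoublingDivisor D.φ Z →
    D.IsChowConvergent 2 1 (D.Zheart Z) ∧ ∀ T, D.interDiag (D.Zheart Z T) = D.Zphi D.φ T

/-- **[Liu2021, (5.8)] AS PRINTED** (p. 77 L13–23): «`I^z_K(f, φ) = ⟨p^*_{135} Δ³_z X_K, (Δ X_K × T^f_K × Z^♥_K).p^*_{246} Δ³_z X_K⟩^{BB}_{X_K⁶}` by
Lemma 3.5», where the Chow convergent formal series `Z^♥_K` enters through its class in `CH¹(X_K × X_K)_ℂ` (Def. 3.3, the carrier `czSum`).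
For every doubling divisor `Z_K` for `φ`. NO PROOF. [cite: Liu2021, (5.8) (p. 77)] -/
def Eq58 : Prop :=
  ∀ Z (hZ : D.IsDoublingDivisor D.φ Z),
    D.IzK Z hZ =
      D.bb6 (2 * (V.n - 1)) ((V.n - 1) + (V.n - 1) + 1 + 2 * (V.n - 1))
        ⟨D.p135 _ D.delta3z, (D.pull_mem0 _ _ D.delta3z_mem).1⟩
        ⟨D.interCH _ _ (D.ext3CH _ _ _ (D.cl 2 _ D.diag) (D.cl 2 _ D.Tf) (D.czSum 2 1 (D.Zheart Z))) (D.p246 _ D.delta3z),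
          D.inter_mem0 _ _ _ _ (D.pull_mem0 _ _ D.delta3z_mem).2⟩

/-- **[Liu2021, Proposition 5.15 (1)] AS PRINTED** (p. 77 L43–47): «Let `K, f, φ, Z_K` be as in Definition 5.12. (1) The cycles
`Δ X_K × T^f_K × Z^♥_K` and `p^*_{246} Δ³ X_K` intersect properly in `X_K⁶`» (termwise in the formal series `Z^♥_K`, READING FS). NO PROOF.
[cite: Liu2021, Prop. 5.15 (1) (p. 77)] -/
def Prop515_1 : Prop :=
  ∀ Z, D.IsDoublingDivisor D.φ Z → ∀ T : E,
    D.ProperInt6 _ _ (D.ext3 _ _ _ D.diag D.Tf (D.Zheart Z T)) D.pd246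

/-- **[Liu2021, Proposition 5.15 (2)] AS PRINTED** (p. 77 L48–53): «(2) If `f ⊗ φ` is regularly supported at some nonarchimedean place `v` of
`F`, then `p^*_{135} Δ³ X_K` and `(Δ X_K × T^f_K × Z^♥_K).p^*_{246} Δ³ X_K` have empty intersection on `X_K⁶`» (termwise, READING FS). NO PROOF.
[cite: Liu2021, Prop. 5.15 (2) (p. 77)] -/
def Prop515_2 : Prop :=
  (∃ v, Sec52Defs.IsRegularlySupportedAt V v (Sec52Defs.tensorFn V D.f D.φ)) →
    ∀ Z, D.IsDoublingDivisor D.φ Z → ∀ T : E,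
      D.EmptyInt6 _ _ D.pd135 (D.inter6 _ _ (D.ext3 _ _ _ D.diag D.Tf (D.Zheart Z T)) D.pd246)

/-! ### Definition 5.16 — good inert primes (p. 78–79), over the tree's App. C §C.4 vocabulary -/

/-- **[Liu2021, Definition 5.16] with its witnesses** (p. 78 L42 – p. 79 L8): «We say that a prime `𝔭` of `F` is a *good inert prime* (with
respect to `K, f, φ`) if • `𝔭` is inert in `E`, • the underlying rational prime `p` is odd and unramified in `E`, • if we denote by `𝔭̲` the set
of all primes of `F` above `p` that are inert in `E`, then there exists a self-dual lattice `Λ_𝔮 ⊆ V(F_𝔮)` for every `𝔮 ∈ 𝔭̲` such that –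
`K = K^p × ∏_{𝔮 ∈ 𝔭̲} K_𝔮` in which `K_𝔮` is the stabilizer of `Λ_𝔮` for every `𝔮 ∈ 𝔭̲`, – `f = f^p ⊗ ⊗_{𝔮 ∈ 𝔭̲} f_𝔮` in which `f_𝔮 = 𝟙_{K_𝔮}`, –
`φ = φ^p ⊗ ⊗_{𝔮 ∈ 𝔭̲} φ_𝔮` in which `φ_𝔮 = 𝟙_{Λ_𝔮}`.»  This predicate fixes the witnesses, as §5.3 refers to them: frames `Λ = (Λ_𝔮)_𝔮` of the
lattices (READING U3 of the tree's §C.4 carpet; only the values at `𝔮 ∈ 𝔭̲` matter) and the factors `f^p`, `φ^p` on the away-from-`𝔭̲`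
components; Def. 5.16 itself is `IsGoodInertPrime` (∃ witnesses).  In the tree's vocabulary (`SecC4IntegralModelsUniformization`): «inert» =
`IsInert E 𝔭`; `p` = `residueChar 𝔭`, «odd» = `≠ 2` (the field `p_odd` there), «unramified in `E`» = `IsUnramifiedRatPrime E p`; `𝔭̲` =
`inertSet E 𝔭`; «self-dual lattice» = `IsSelfDualFrame V 𝔮 (Λ 𝔮)`; «the stabilizer of `Λ_𝔮`» = `latticeStabilizer V 𝔮 (Λ 𝔮)`; since `K` is
decomposable, «`K = K^p × ∏ K_𝔮`» says that the `𝔮`-component `K_𝔮 = levelAt V K 𝔮` is that stabilizer for `𝔮 ∈ 𝔭̲`. REAL.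
[cite: Liu2021, Def. 5.16 (pp. 78–79)] -/
def IsGoodInertPrimeWith (𝔭 : HeightOneSpectrum (𝓞 F))
    (Λ : ∀ 𝔮 : HeightOneSpectrum (𝓞 F), UnitaryGroup.LocalGLPi E V.n 𝔮)
    (fp : ((u : {u : HeightOneSpectrum (𝓞 F) // u ∉ inertSet E 𝔭}) →
      UnitaryGroup.localPi E (conj F E) V.n V.gram u.1) → ℂ)
    (φp : ((w : {w : HeightOneSpectrum (𝓞 E) // w.under (𝓞 F) ∉ inertSet E 𝔭}) → Fin V.n → w.1.adicCompletion E) → ℂ) :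
    Prop :=
  IsInert E 𝔭 ∧
  (residueChar 𝔭 ≠ 2 ∧ IsUnramifiedRatPrime E (residueChar 𝔭)) ∧
  (∀ 𝔮 ∈ inertSet E 𝔭,
    IsSelfDualFrame V 𝔮 (Λ 𝔮) ∧ Sec52Defs.levelAt V D.K 𝔮 = latticeStabilizer V 𝔮 (Λ 𝔮)) ∧
  (∀ g : V.Gfin, D.f g = fp (awayG V (inertSet E 𝔭) g) *
      ∏ᶠ (𝔮 : HeightOneSpectrum (𝓞 F)) (_ : 𝔮 ∈ inertSet E 𝔭),
        Set.indicator (Sec52Defs.levelAt V D.K 𝔮 : Set _) (fun _ => (1 : ℂ))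
          (UnitaryGroup.evalPlace F E (conj F E) V.n V.gram 𝔮 g)) ∧
  (∀ x : Sec52Defs.VAd V, D.φ x = φp (awayV V (inertSet E 𝔭) x) *
      ∏ᶠ (𝔮 : HeightOneSpectrum (𝓞 F)) (_ : 𝔮 ∈ inertSet E 𝔭),
        Set.indicator (latticeOfFrame V 𝔮 (Λ 𝔮)) (fun _ => (1 : ℂ)) (locV V 𝔮 x))

/-- **[Liu2021, Definition 5.16]** (p. 78 L42 – p. 79 L8; verbatim wording on `IsGoodInertPrimeWith`): `𝔭` is a good inert prime with respect to
`(K, f, φ)` iff witnesses — self-dual frames `(Λ_𝔮)` and factors `f^p`, `φ^p` as printed — exist. REAL. [cite: Liu2021, Def. 5.16 (pp. 78–79)] -/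
def IsGoodInertPrime (𝔭 : HeightOneSpectrum (𝓞 F)) : Prop := ∃ Λ fp φp, D.IsGoodInertPrimeWith 𝔭 Λ fp φp

end Sec52Data

/-! ### The local arithmetic invariant functional at a good inert prime (p. 79–80) -/

/-- **Data of [Liu2021, §5.2 at a good inert prime]** (p. 79 L10–29): «We fix a good inert prime `𝔭`. From now on, we work in the category
`Sch_{/𝒪_{E_𝔭}}`. Let `𝒳_K` be the canonical integral model of `X_K` over `𝒪_{E_𝔭}` (Definition C.21), which is a proper smooth scheme in
`Sch_{/𝒪_{E_𝔭}}` of relative dimension `n − 1`. Then the Zariski closure of `T^f_K` in `𝒳_K × 𝒳_K` is an étale correspondence, which will be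
denoted by the same notation. Let `𝒵_K` (resp. `𝒵(φ)_K`) be the Zariski closure of `Z_K` (resp. `Z(φ)_K`) in `𝒳_K × 𝒳_K` (resp. `𝒳_K`).»
Extends `Sec52Data` (parameter: the prime `𝔭`) by the witnesses of Def. 5.16 for `𝔭` (REAL hypothesis `good`) and by ⟨CARRIER⟩s for the
objects the text names on the self-products `𝒳_K^m` over `𝒪_{E_𝔭}` (the canonical integral model itself is Def. C.21 = the tree's
`SecC4IntegralModelsUniformization.CanonicalIntegralModel`, anchored in the §5.3 companion's datum): cycles with complex coefficients, Zariski closure, the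
diagonal and partial diagonals, exterior products, `p_2^*`, proper intersections (convention (2)), and the numerical invariant
`(A, B) ↦ χ(𝒪(A) ⊗^𝕃 𝒪(B))` of Def. 5.17 / Rem. 5.18 («`χ` denotes the Euler–Poincaré characteristic»; «for a formal series `∑_j c_j Z_j` of
cycles on `𝒳_K⁶`, we put `𝒪(∑_j c_j Z_j) := ∑_j c_j 𝒪_{Z_j}` as a formal series of `𝒪_{𝒳_K⁶}`-modules», p. 79 L48–62) extended
`ℂ`-bilinearly.  Nothing is asserted. [cite: Liu2021, §5.2 (pp. 79–80)] -/
structure Sec52IntData (V : HermSpace F E) (τ' : E →+* ℂ) (S : V.ShimuraSystem τ') (𝔭 : HeightOneSpectrum (𝓞 F))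
    extends Sec52Data F E V τ' S where
  /-- frames of the self-dual lattices `Λ_𝔮`, `𝔮 ∈ 𝔭̲`, of Def. 5.16 (READING U3; values off `𝔭̲` unused). -/
  Λ : ∀ 𝔮 : HeightOneSpectrum (𝓞 F), UnitaryGroup.LocalGLPi E V.n 𝔮
  /-- the factor «`f^p`» of Def. 5.16 (on the away-from-`𝔭̲` components). -/
  fp : ((u : {u : HeightOneSpectrum (𝓞 F) // u ∉ inertSet E 𝔭}) → UnitaryGroup.localPi E (conj F E) V.n V.gram u.1) → ℂ
  /-- the factor «`φ^p`» of Def. 5.16. -/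
  φp : ((w : {w : HeightOneSpectrum (𝓞 E) // w.under (𝓞 F) ∉ inertSet E 𝔭}) → Fin V.n → w.1.adicCompletion E) → ℂ
  /-- «We fix a good inert prime `𝔭`» (p. 79 L10): `𝔭` is a good inert prime with respect to `(K, f, φ)` with these witnesses (Def. 5.16).
  REAL hypothesis. -/
  good : toSec52Data.IsGoodInertPrimeWith 𝔭 Λ fp φp
  /-- ⟨CARRIER⟩ the cycles of codimension `i` with complex coefficients on `𝒳_K^m = 𝒳_K ×_{𝒪_{E_𝔭}} ⋯ ×_{𝒪_{E_𝔭}} 𝒳_K` (p. 79: «`𝒳_K × 𝒳_K`»,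
  «cycles on `𝒳_K⁶`»), and formal series thereof under READING FS. -/
  ZcI : ℕ → ℕ → ModuleCat.{0} ℂ
  /-- ⟨CARRIER⟩ Zariski closure `Z^i(X_K^m)_ℂ → Z^i(𝒳_K^m)_ℂ` (p. 79 L14–18), extended `ℂ`-linearly. -/
  closure : ∀ m i, Zc m i →ₗ[ℂ] ZcI m i
  /-- ⟨CARRIER⟩ the diagonal `Δ 𝒳_K` of `𝒳_K × 𝒳_K` as a cycle (p. 79 L23 «`Δ 𝒳_K . 𝒵_K`»; p. 80 L8 «`𝒪(Δ 𝒵(φ)_K)`»). -/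
  diagI : ZcI 2 (V.n - 1)
  /-- ⟨CARRIER⟩ the cycles `p^*_{135} Δ³ 𝒳_K`, `p^*_{246} Δ³ 𝒳_K` on `𝒳_K⁶` (Def. 5.17, p. 79 L40–41). -/
  pd135I : ZcI 6 (2 * (V.n - 1))
  /-- ⟨CARRIER⟩ `p^*_{246} Δ³ 𝒳_K`. -/
  pd246I : ZcI 6 (2 * (V.n - 1))
  /-- ⟨CARRIER⟩ exterior product of cycles `Z^a(𝒳_K²) × Z^b(𝒳_K²) × Z^c(𝒳_K²) → Z^{a+b+c}(𝒳_K⁶)` («`Δ 𝒳_K × T^f_K × 𝒵^♥_K`», p. 79 L40). -/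
  ext3I : ∀ a b c, ZcI 2 a → ZcI 2 b → ZcI 2 c → ZcI 6 (a + b + c)
  /-- ⟨CARRIER⟩ `p_2^* : Z^j(𝒳_K)_ℂ → Z^j(𝒳_K × 𝒳_K)_ℂ` ((5.9)). -/
  p2pullI : ∀ j, ZcI 1 j →ₗ[ℂ] ZcI 2 j
  /-- ⟨CARRIER⟩ `Z ↦ Δ 𝒳_K . Z ∈ Z¹(𝒳_K)_ℂ` for `Z ∈ Z¹(𝒳_K × 𝒳_K)_ℂ` meeting the diagonal properly ((5.9)). -/
  interDiagI : ZcI 2 1 → ZcI 1 1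
  /-- ⟨CARRIER⟩ «proper intersection» of two cycles on `𝒳_K⁶` (Prop. 5.19's proof, p. 80 L11–14; convention (2)). -/
  ProperInt6I : ∀ a b, ZcI 6 a → ZcI 6 b → Prop
  /-- ⟨CARRIER⟩ the cycle `A.B` of convention (2) on the regular scheme `𝒳_K⁶` («`(Δ 𝒳_K × T^f_K × 𝒵^♥_K).p^*_{246} Δ³ 𝒳_K`», p. 79 L40–41). -/
  inter6I : ∀ a b, ZcI 6 a → ZcI 6 b → ZcI 6 (a + b)
  /-- ⟨CARRIER⟩ `(A, B) ↦ χ(𝒪(A) ⊗^𝕃_{𝒪_{𝒳_K⁶}} 𝒪(B))` on cycles of `𝒳_K⁶` with complex coefficients (Def. 5.17 / Rem. 5.18; `ℂ`-bilinear by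
  «`𝒪(∑_j c_j Z_j) := ∑_j c_j 𝒪_{Z_j}`», p. 79 L48–62; meaningful where the derived tensor product lies in `D^b_{coh}` of the special fibre,
  Rem. 5.18). -/
  chi6 : ∀ a b, ZcI 6 a →ₗ[ℂ] ZcI 6 b →ₗ[ℂ] ℂ
  /-- ⟨CARRIER⟩ «is (a formal series) in `D^b_{coh}(𝒳_K⁶ ⊗_{ℤ_p} 𝔽_p)`» for the derived tensor product `𝒪(A) ⊗^𝕃 𝒪(B)` (Rem. 5.18, p. 79
  L63–70: «For a Noetherian scheme `X`, we denote by `D^b_{coh}(X)` the bounded derived category of `𝒪_X`-modules with coherent cohomology»). -/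
  InDbcohModP : ∀ a b, ZcI 6 a → ZcI 6 b → Prop
  /-- ⟨CARRIER⟩ `(A, B) ↦ χ(𝒪(A) ⊗^𝕃_{𝒪_{𝒳_K²}} 𝒪(B))` on cycles of `𝒳_K × 𝒳_K` (Prop. 5.19: «`χ(𝒪(T^f_K) ⊗^𝕃_{𝒪_{𝒳_K²}} 𝒪(Δ 𝒵(φ)_K))`»). -/
  chi2 : ∀ a b, ZcI 2 a →ₗ[ℂ] ZcI 2 b →ₗ[ℂ] ℂ
  /-- ⟨CARRIER⟩ `Z ↦ Δ Z`, a cycle of `𝒳_K` placed on the diagonal of `𝒳_K × 𝒳_K` (p. 80 L8, L96–97: «`𝒪(Δ 𝒳_K ∩ 𝒵^♥_K) = 𝒪(Δ 𝒵(φ)_K)`»),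
  `ℂ`-linearly. -/
  diagEmbI : ∀ j, ZcI 1 j →ₗ[ℂ] ZcI 2 (j + (V.n - 1))

namespace Sec52IntData

variable {F E}
variable {V : HermSpace F E} {τ' : E →+* ℂ} {S : V.ShimuraSystem τ'} {𝔭 : HeightOneSpectrum (𝓞 F)} (D : Sec52IntData F E V τ' S 𝔭)

/-- The Zariski closure `T^f_K` on `𝒳_K × 𝒳_K` «denoted by the same notation» (p. 79 L14–15). [cite: Liu2021, §5.2 (p. 79)] -/
abbrev TfI : D.ZcI 2 (V.n - 1) := D.closure 2 _ D.Tf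

/-- **[Liu2021, (5.9)]** (p. 79 L18–28): «Similar to `Z^♥_K`, we put `𝒵^♥_K := 𝒵_K − p_2^*(Δ 𝒳_K . 𝒵_K − 𝒵(φ)_K)`, which is a formal series of
divisors on `𝒳_K` [sic], whose generic fiber is `Z^♥_K`», `𝒵_K`, `𝒵(φ)_K` the Zariski closures (READING FS, termwise). REAL over the
carriers. [cite: Liu2021, (5.9) (p. 79)] -/
def ZheartI (Z : D.Zc 2 1) (T : E) : D.ZcI 2 1 :=
  haveI := Classical.decEq E
  (if T = 0 then D.closure 2 1 Z - D.p2pullI 1 (D.interDiagI (D.closure 2 1 Z)) else 0) +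
    D.p2pullI 1 (D.closure 1 1 (D.Zphi D.φ T))

/-- **[Liu2021, Definition 5.17] (Local arithmetic invariant functional)** (p. 79 L31–62): «Let `K, f, φ, Z_K` be as in Definition 5.12 such
that `f ⊗ φ` is regularly supported at some nonarchimedean place `v` of `F`, we define the local arithmetic invariant functional at (a good
inert prime) `𝔭` to be `I_K(f, φ)_𝔭 := 2 log |𝒪_F/𝔭| · χ(𝒪(p^*_{135} Δ³ 𝒳_K) ⊗^𝕃_{𝒪_{𝒳_K⁶}} 𝒪((Δ 𝒳_K × T^f_K × 𝒵^♥_K).p^*_{246} Δ³ 𝒳_K))`,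
where `χ` denotes the Euler–Poincaré characteristic (see Remark 5.18 below), and for a formal series `∑_j c_j Z_j` of cycles on `𝒳_K⁶`, we put
`𝒪(∑_j c_j Z_j) := ∑_j c_j 𝒪_{Z_j}` as a formal series of `𝒪_{𝒳_K⁶}`-modules.»  (Footnote 11: «It is clear that `v` can not be in `𝔭̲`.»)
A formal series in `ℂ` (Rem. 5.18; READING FS: the family of its parts of index `T`); a function of the chosen doubling divisor `Z` and
of the printed hypotheses (unused in the value). REAL over the carriers. [cite: Liu2021, Def. 5.17 (p. 79)] -/
def IKp (Z : D.Zc 2 1) (_hZ : D.IsDoublingDivisor D.φ Z)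
    (_hrs : ∃ v, Sec52Defs.IsRegularlySupportedAt V v (Sec52Defs.tensorFn V D.f D.φ)) (T : E) : ℂ :=
  (twoLogNorm 𝔭 : ℂ) * D.chi6 _ _ D.pd135I (D.inter6I _ _ (D.ext3I _ _ _ D.diagI D.TfI (D.ZheartI Z T)) D.pd246I)

/-- **[Liu2021, Remark 5.18] AS PRINTED** (p. 79 L63–72): «For a Noetherian scheme `X`, we denote by `D^b_{coh}(X)` the bounded derived category
of `𝒪_X`-modules with coherent cohomology. By Proposition 5.15(2), `𝒪(p^*_{135} Δ³ 𝒳_K) ⊗^𝕃_{𝒪_{𝒳_K⁶}} 𝒪((Δ 𝒳_K × T^f_K × 𝒵^♥_K).p^*_{246} Δ³ 𝒳_K)`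
is a formal series in `D^b_{coh}(𝒳_K⁶ ⊗_{ℤ_p} 𝔽_p)`, which implies that its Euler–Poincaré characteristic is a formal series in `ℂ`.»  Typed: the
membership claim, termwise (READING FS), under the hypothesis of Def. 5.17. NO PROOF. [cite: Liu2021, Rem. 5.18 (p. 79)] -/
def Rem518 : Prop :=
  (∃ v, Sec52Defs.IsRegularlySupportedAt V v (Sec52Defs.tensorFn V D.f D.φ)) →
    ∀ Z, D.IsDoublingDivisor D.φ Z → ∀ T : E,
      D.InDbcohModP _ _ D.pd135I (D.inter6I _ _ (D.ext3I _ _ _ D.diagI D.TfI (D.ZheartI Z T)) D.pd246I)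

/-- **[Liu2021, Proposition 5.19] AS PRINTED** (p. 80 L5–9): «In the situation of Definition 5.17, we have
`I_K(f, φ)_𝔭 = 2 log |𝒪_F/𝔭| · χ(𝒪(T^f_K) ⊗^𝕃_{𝒪_{𝒳_K²}} 𝒪(Δ 𝒵(φ)_K))`.» (READING FS: termwise in the index `T`; `Δ 𝒵(φ)_K` = the Zariski
closure of `Z(φ)_K` placed on the diagonal.) NO PROOF. [cite: Liu2021, Prop. 5.19 (p. 80)] -/
def Prop519 : Prop :=
  ∀ Z (hZ : D.IsDoublingDivisor D.φ Z) (hrs : ∃ v, Sec52Defs.IsRegularlySupportedAt V v (Sec52Defs.tensorFn V D.f D.φ)) (T : E),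
    D.IKp Z hZ hrs T = (twoLogNorm 𝔭 : ℂ) * D.chi2 _ _ D.TfI (D.diagEmbI 1 (D.closure 1 1 (D.Zphi D.φ T)))

end Sec52IntData

end Sec52

end Literature.NumberTheory.Automorphic.Liu2021.Sec52ArithmeticInvariantFunctionals

end
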